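/-
Copyright (c) 2026. All rights reserved.
Released under Apache 2.0 license as described in the file LICENSE.
Authors: abc-iut cell, wave-5 seat abc-iut-w5-d141 (L3 sub-DAG [SemiAnbd] Thm 5.4, row T54-7, input hZ).
-/
import Mathlib.GroupTheory.Commensurable
import Mathlib.Topology.Algebra.Group.Basic
import Literature.AnabelianGeometry.SemiGraphs.ArithmeticCoverings
import HarnessLib

/-!
# [SemiAnbd] Theorem 5.4 (iii), clause 3: the relative temp-slimness input, from p. 65 and Prop 5.2 (iii)
# (sub-DAG SemiAnbd-Thm54, row T54-7; proof-only)

Mochizuki, *Semi-graphs of anabelioids*, Publ. RIMS **42** (2006), §5, p. 65 ("`Π^temp_{𝔊,v}` … may be thought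
of [cf. Cor 2.7 (i),(iii); Prop 3.6 (iii)] as the commensurator in `Π^temp_𝔊` of `Π^temp_{𝔾,v}`") and Prop 5.2
(iii) p. 64 (temp-slimness), as used in the arithmetic translation of Cor 3.9 for Thm 5.4 (iii), p. 66
[cite: MochizukiSemiAnbd2006, Thm 5.4 (iii), p. 66].

PROOF-ONLY companion of `ArithQuasiGeometricSurjective.lean` (abc-iut-w5-d141, p415150): its binder `hZ` ("an
element of `Ker augH'` centralising an open subgroup of a geometric verticial subgroup
`x Π^temp_{ℍ,w} x⁻¹ ∩ Ker augH'` is trivial") is DERIVED here (`relSlim_of_commensurator_slim`) from the producer's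
standard currency (coordinator menu T54-INTERFACES): the commensurator description `hcommV'` of p. 65,
compactness of the verticial representatives (Rmk 5.3.1), continuity of `augH'` with `Π_A` Hausdorff-`T₁`, and
SLIMNESS of the geometric verticial subgroups (verticial slimness of `ℍ`, Def 5.1 (i) / Prop 5.2 (iii)).
Mechanism: the centralising element commensurates the geometric verticial subgroup (an open subgroup of a
compact group has finite index), hence lies in the conjugate arithmetic vertex group by `hcommV'`, hence —
being geometric — in the geometric verticial subgroup itself, where slimness kills it.  Nothing asserted;
no side on [IUTchIII] Cor 3.12.
-/

namespace Literature.AnabelianGeometry.SemiGraphs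

open scoped Pointwise
open Literature.AlgebraicGeometry.Frobenioids (IsSlimGroup)

universe uH uP uV' uB'

variable {Htp : Type uH} [Group Htp] [TopologicalSpace Htp] [IsTopologicalGroup Htp] [T2Space Htp]
variable {PA : Type uP} [Group PA] [TopologicalSpace PA] [T1Space PA]
variable {V' : Type uV'} {B' : Type uB'} {D' : DecompositionData Htp V' B'} {augH' : Htp →* PA}

omit [TopologicalSpace Htp] [IsTopologicalGroup Htp] [T2Space Htp] [TopologicalSpace PA] [T1Space PA] in
/-- Conjugating by `g` commutes with intersecting with the normal subgroup `Ker augH'`.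
[cite: MochizukiSemiAnbd2006, §0, p. 5] -/
theorem conjSubgroup_inf_ker (g : Htp) (K : Subgroup Htp) :
    conjSubgroup g K ⊓ augH'.ker = conjSubgroup g (K ⊓ augH'.ker) := by
  apply le_antisymm
  · intro y hy
    obtain ⟨hy₁, hy₂⟩ := Subgroup.mem_inf.mp hy
    obtain ⟨k, hk, rfl⟩ := hy₁
    refine ⟨k, Subgroup.mem_inf.mpr ⟨hk, ?_⟩, rfl⟩
    have hy' : (MulAut.conj g) k ∈ augH'.ker := hy₂
    rw [MulAut.conj_apply] at hy'
    have h := (MonoidHom.normal_ker augH').conj_mem _ hy' g⁻¹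
    rwa [inv_inv, ← mul_assoc, ← mul_assoc, inv_mul_cancel, one_mul, mul_assoc, inv_mul_cancel,
      mul_one] at h
  · rintro _ ⟨k, hk, rfl⟩
    obtain ⟨hkK, hkker⟩ := Subgroup.mem_inf.mp hk
    exact Subgroup.mem_inf.mpr ⟨⟨k, hkK, rfl⟩, (MonoidHom.normal_ker augH').conj_mem _ hkker g⟩

omit [T2Space Htp] [TopologicalSpace PA] [T1Space PA] in
/-- An element centralising a subgroup `U` that is OPEN in a COMPACT subgroup `M` commensurates `M`
(an open subgroup of a compact group has finite index). [cite: MochizukiSemiAnbd2006, §0, p. 5] -/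
theorem mem_commensurator_of_centralizes_open {U M : Subgroup Htp} (hUM : U ≤ M)
    (hMc : IsCompact (M : Set Htp)) (hU : IsOpen ((Subtype.val : M → Htp) ⁻¹' (U : Set Htp)))
    {z : Htp} (hz : ∀ u ∈ U, z * u = u * z) : z ∈ Subgroup.Commensurable.commensurator M := by
  -- `U` has finite index in the compact group `M`, so `U` and `M` are commensurable
  haveI : CompactSpace M := isCompact_iff_compactSpace.mp hMc
  have hopen : IsOpen ((U.subgroupOf M : Subgroup M) : Set M) := by
    rw [Subgroup.coe_subgroupOf]; exact hU
  haveI : DiscreteTopology (M ⧸ U.subgroupOf M) := QuotientGroup.discreteTopology_iff.mpr hopen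
  haveI : Finite (M ⧸ U.subgroupOf M) := finite_of_compact_of_discrete
  have hfi : (U.subgroupOf M).FiniteIndex := Subgroup.finiteIndex_of_finite_quotient
  have hUM' : Subgroup.Commensurable U M :=
    ⟨hfi.index_ne_zero, by rw [Subgroup.relIndex_eq_one.mpr hUM]; exact one_ne_zero⟩
  -- `z` fixes `U` pointwise, hence `z • U = U`
  have hfix : ∀ u ∈ U, ConjAct.toConjAct z • u = u := fun u hu => by
    rw [ConjAct.toConjAct_smul, hz u hu, mul_inv_cancel_right]
  have hzU : ConjAct.toConjAct z • U = U := by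
    apply le_antisymm
    · intro y hy
      obtain ⟨u, hu, rfl⟩ := (Subgroup.mem_smul_pointwise_iff_exists _ _ _).mp hy
      rw [hfix u hu]; exact hu
    · intro u hu
      exact (Subgroup.mem_smul_pointwise_iff_exists _ _ _).mpr ⟨u, hu, hfix u hu⟩
  -- `z • M ~ z • U = U ~ M`
  rw [Subgroup.Commensurable.commensurator_mem_iff]
  have h1 : Subgroup.Commensurable (ConjAct.toConjAct z • U) (ConjAct.toConjAct z • M) :=
    (Subgroup.Commensurable.commensurable_conj _).mp hUM'
  rw [hzU] at h1
  exact h1.symm.trans hUM'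

/-- **The binder `hZ` of `Thm54iii.clause3_of_geometric` from the producer's currency** (relative
temp-slimness): an element of `Ker augH'` centralising a subgroup `U` that is open in the geometric verticial
subgroup `x Π^temp_{ℍ,w} x⁻¹ ∩ Ker augH'` is trivial — from the commensurator description of p. 65 (`hcommV'`),
compactness of the verticial representatives (Rmk 5.3.1), continuity of `augH'` (with `Π_A` `T₁`), and slimness
of the geometric verticial subgroups (Prop 5.2 (iii) / verticial slimness of `ℍ`).
[cite: MochizukiSemiAnbd2006, Thm 5.4 (iii), p. 66] -/
theorem relSlim_of_commensurator_slim (haug : Continuous augH')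
    (hcommV' : ∀ w : V', Subgroup.Commensurable.commensurator (D'.vertGp w ⊓ augH'.ker) = D'.vertGp w)
    (hcpt : ∀ w : V', IsCompact (D'.vertGp w : Set Htp))
    (hslim : ∀ (w : V') (x : Htp), IsSlimGroup (conjSubgroup x (D'.vertGp w) ⊓ augH'.ker : Subgroup Htp)) :
    ∀ (w : V') (x : Htp) (U : Subgroup Htp), U ≤ conjSubgroup x (D'.vertGp w) ⊓ augH'.ker →
      IsOpen ((Subtype.val : (conjSubgroup x (D'.vertGp w) ⊓ augH'.ker : Subgroup Htp) → Htp) ⁻¹'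
        (U : Set Htp)) →
      ∀ z ∈ augH'.ker, (∀ u ∈ U, z * u = u * z) → z = 1 := by
  intro w x U hUM hU z hz hcomm
  set M : Subgroup Htp := conjSubgroup x (D'.vertGp w) ⊓ augH'.ker with hM
  -- `M` is compact
  have hMc : IsCompact (M : Set Htp) := by
    have h1 : IsCompact (conjSubgroup x (D'.vertGp w) : Set Htp) := by
      have : (conjSubgroup x (D'.vertGp w) : Set Htp) = (fun y => x * y * x⁻¹) '' (D'.vertGp w : Set Htp) := by
        ext y; simp [conjSubgroup, MulAut.conj_apply]
      rw [this]
      exact (hcpt w).image (by fun_prop)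
    refine h1.of_isClosed_subset ?_ inf_le_left
    change IsClosed ((conjSubgroup x (D'.vertGp w) : Set Htp) ∩ (augH'.ker : Set Htp))
    refine h1.isClosed.inter ?_
    rw [MonoidHom.coe_ker]
    exact isClosed_singleton.preimage haug
  -- `z` commensurates `M = x (Π_{ℍ,w} ∩ Ker) x⁻¹`, hence `x⁻¹ z x` commensurates `Π_{ℍ,w} ∩ Ker`
  have hzM : z ∈ Subgroup.Commensurable.commensurator M :=
    mem_commensurator_of_centralizes_open hUM hMc hU hcomm
  set N : Subgroup Htp := D'.vertGp w ⊓ augH'.ker with hN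
  have hMN : M = ConjAct.toConjAct x • N := by
    rw [hM, conjSubgroup_inf_ker]; rfl
  have hzN : x⁻¹ * z * x ∈ Subgroup.Commensurable.commensurator N := by
    rw [Subgroup.Commensurable.commensurator_mem_iff] at hzM ⊢
    rw [hMN] at hzM
    have h2 := (Subgroup.Commensurable.commensurable_conj (ConjAct.toConjAct x)⁻¹).mp hzM
    rw [smul_smul, smul_smul, inv_smul_smul] at h2
    have hx : (ConjAct.toConjAct x)⁻¹ * ConjAct.toConjAct z * ConjAct.toConjAct x =
        ConjAct.toConjAct (x⁻¹ * z * x) := by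
      rw [← map_inv, ← map_mul, ← map_mul]
    rwa [hx] at h2
  -- so `x⁻¹ z x ∈ Π_{ℍ,w}` (commensurator description) and, being geometric, `∈ N`; hence `z ∈ M`
  rw [hcommV' w] at hzN
  have hzker : x⁻¹ * z * x ∈ augH'.ker := (MonoidHom.normal_ker augH').conj_mem' _ hz x
  have hzM' : z ∈ M := by
    rw [hMN]
    refine (Subgroup.mem_smul_pointwise_iff_exists _ _ _).mpr ⟨x⁻¹ * z * x, Subgroup.mem_inf.mpr ⟨hzN, ?_⟩, ?_⟩
    · simpa [mul_assoc] using hzker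
    · rw [ConjAct.toConjAct_smul]; group
  -- slimness of `M` finishes
  have hcen : (⟨z, hzM'⟩ : M) ∈ Subgroup.centralizer ((U.subgroupOf M : Subgroup M) : Set M) := by
    rw [Subgroup.mem_centralizer_iff]
    rintro ⟨u, huM⟩ hu
    rw [SetLike.mem_coe, Subgroup.mem_subgroupOf] at hu
    exact Subtype.ext ((hcomm u hu).symm)
  have hopen : IsOpen ((U.subgroupOf M : Subgroup M) : Set M) := by
    rw [Subgroup.coe_subgroupOf]; exact hU
  rw [(hslim w x).centralizer_eq_bot _ hopen, Subgroup.mem_bot] at hcen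
  exact congrArg Subtype.val hcen

end Literature.AnabelianGeometry.SemiGraphs
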